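import Literature.MathematicalPhysics.KineticTheory.InfiniteChainGibbsNormalisable
import Literature.MathematicalPhysics.KineticTheory.InfiniteChainSpecificationLocality
import HarnessLib

/-!
# The value of a window event under a tight DLR state of the chain

Topic `Literature/MathematicalPhysics/KineticTheory`; theorems only (no definitions, no named
facts). The measure-theoretic endgame of the transfer-operator proof of uniqueness of
one-dimensional Gibbs states (Cassandro–Olivieri–Pellegrinotti–Presutti 1978 §2; Georgii 2011,
Thm 10.25, §11.1), isolated from the spectral estimate: IF the finite-volume Gibbs probabilities
`γ_{ {a-N,…,a+n+N} }(A | η)` of a window event `A` converge to `L ∈ [0,1]` uniformly over the boundary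
conditions `η` with `|q_{a-N-1}|, |q_{a+n+N+1}| ≤ R` (for every `R`; this is
`OscillatorChain.chainSpecification_Icc_tendsto_uniformly` of `InfiniteChainGibbsUniqueness.lean`),
THEN every DLR state `μ` whose one-site position marginals are uniformly tight has `μ(A) = L`
(`measureReal_eq_of_isChainGibbsMeasure_of_tight`): by the DLR equation
`μ(A) = ∫ γ_Λ(A | η) dμ(η)` the integrand is `ε`-close to `L` off a set of `μ`-measure `≤ 2ε`.
[folklore]
-/

noncomputable section

open MeasureTheory Set Function Finset Filter Literature.Probability.LatticeModels
open scoped ENNReal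

namespace Literature.MathematicalPhysics.KineticTheory.HeatConduction

namespace OscillatorChain

variable (P : OscillatorChain)

/-- **A tight DLR state gives every window event its boundary-condition-free limit value.** If
`μ` is a DLR Gibbs state of `P` at `T` whose one-site position marginals are uniformly tight, `A` is
measurable, and the finite-volume probabilities `γ_{ {a-N,…,a+n+N} }(A | η)` converge to `L ∈ [0,1]`
uniformly on `{|q_{a-N-1}|, |q_{a+n+N+1}| ≤ R}` for every `R`, then `μ(A) = L`: by the DLR equation
`μ(A) = ∫ γ_Λ(A | η) dμ(η)`, and the integrand is `ε`-close to `L` off a set of `μ`-measure `≤ 2ε`.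
[folklore] -/
theorem measureReal_eq_of_isChainGibbsMeasure_of_tight {T : ℝ} (hT : 0 < T)
    (hUc : Continuous P.U) (hVc : Continuous P.V) (hV0 : ∀ r, 0 ≤ P.V r)
    (hUi : Integrable (fun q : ℝ => Real.exp (-T⁻¹ * P.U q)))
    {μ : Measure ChainConfig} (hG : P.IsChainGibbsMeasure T μ)
    (htight : ∀ ε : ℝ, 0 < ε → ∃ R : ℝ, ∀ x : ℤ,
      μ {σ : ChainConfig | R < |(σ x).1|} ≤ ENNReal.ofReal ε)
    (a : ℤ) (n : ℕ) {A : Set ChainConfig} (hA : MeasurableSet A) {L : ℝ} (hL0 : 0 ≤ L) (hL1 : L ≤ 1)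
    (hlim : ∀ R ε : ℝ, 0 < ε → ∃ N₀ : ℕ, ∀ N : ℕ, N₀ ≤ N →
      ∀ η : ChainConfig, |(η (a - N - 1)).1| ≤ R → |(η (a + n + N + 1)).1| ≤ R →
        |((P.chainSpecification T (Finset.Icc (a - N) (a + n + N)) η) A).toReal - L| < ε) :
    μ.real A = L := by
  haveI := hG.1
  have hUm : Measurable P.U := hUc.measurable
  have hVm : Measurable P.V := hVc.measurable
  have hprob : ∀ (Λ : Finset ℤ) (η : ChainConfig), IsProbabilityMeasure (P.chainSpecification T Λ η) := by
    have hUint : Integrable (fun q : ℝ => Real.exp (-P.U q / T)) := by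
      have : (fun q : ℝ => Real.exp (-P.U q / T)) = fun q => Real.exp (-T⁻¹ * P.U q) :=
        funext fun q => by rw [show -P.U q / T = -T⁻¹ * P.U q by ring]
      rw [this]; exact hUi
    exact P.condB2_of_integrable_exp_neg hT hUc hVc hV0 hUint
  -- `|μ(A) - L| ≤ 3ε` for every `ε > 0`
  have hbound : ∀ ε : ℝ, 0 < ε → |μ.real A - L| ≤ 3 * ε := by
    intro ε hε
    obtain ⟨R, hR⟩ := htight ε hε
    obtain ⟨N, hN⟩ := hlim R ε hε
    set Λ : Finset ℤ := Finset.Icc (a - N) (a + n + N) with hΛ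
    set f : ChainConfig → ℝ≥0∞ := fun η => P.chainSpecification T Λ η A with hf
    have hfm : Measurable f := P.measurable_chainSpecification_apply hUm hVm T Λ hA
    have hf1 : ∀ η, f η ≤ 1 := fun η => by
      haveI := hprob Λ η
      exact prob_le_one
    have hflt : ∀ η, f η < ∞ := fun η => (hf1 η).trans_lt ENNReal.one_lt_top
    set g : ChainConfig → ℝ := fun η => (f η).toReal with hg
    have hgm : Measurable g := ENNReal.measurable_toReal.comp hfm
    have hg0 : ∀ η, 0 ≤ g η := fun η => ENNReal.toReal_nonneg
    have hg1 : ∀ η, g η ≤ 1 := fun η =>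
      ENNReal.toReal_le_of_le_ofReal zero_le_one (by rw [ENNReal.ofReal_one]; exact hf1 η)
    have hgi : Integrable g μ := (integrable_const (1 : ℝ)).mono' hgm.aestronglyMeasurable
      (Eventually.of_forall fun η => by rw [Real.norm_eq_abs, abs_of_nonneg (hg0 η)]; exact hg1 η)
    -- DLR: `μ(A) = ∫ g dμ`
    have hDLR : μ.real A = ∫ η, g η ∂μ := by
      rw [hg]
      simp only [hf]
      rw [integral_toReal hfm.aemeasurable (Eventually.of_forall hflt), hG.2 Λ A hA, measureReal_def]
    -- the bad set
    set bad : Set ChainConfig := {η | R < |(η (a - N - 1)).1|} ∪ {η | R < |(η (a + n + N + 1)).1|}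
      with hbad
    have hmeas : ∀ x : ℤ, MeasurableSet {η : ChainConfig | R < |(η x).1|} := fun x =>
      measurableSet_lt measurable_const (continuous_abs.measurable.comp (measurable_pi_apply x).fst)
    have hbadm : MeasurableSet bad := (hmeas _).union (hmeas _)
    have hbadμ : μ.real bad ≤ 2 * ε := by
      calc μ.real bad ≤ μ.real {η : ChainConfig | R < |(η (a - N - 1)).1|} +
            μ.real {η : ChainConfig | R < |(η (a + n + N + 1)).1|} := measureReal_union_le _ _
        _ ≤ ε + ε := by
            gcongr
            · exact ENNReal.toReal_le_of_le_ofReal hε.le (hR _)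
            · exact ENNReal.toReal_le_of_le_ofReal hε.le (hR _)
        _ = 2 * ε := by ring
    -- pointwise bound
    have hpt : ∀ η, |g η - L| ≤ ε + bad.indicator (1 : ChainConfig → ℝ) η := by
      intro η
      by_cases hη : η ∈ bad
      · rw [indicator_of_mem hη, Pi.one_apply]
        have : |g η - L| ≤ 1 := abs_sub_le_iff.2 ⟨by linarith [hg1 η], by linarith [hg0 η]⟩
        linarith
      · rw [indicator_of_notMem hη, add_zero]
        rw [hbad] at hη
        simp only [Set.mem_union, Set.mem_setOf_eq, not_or, not_lt] at hη
        exact (hN N le_rfl η hη.1 hη.2).le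
    have hind : Integrable (bad.indicator (1 : ChainConfig → ℝ)) μ :=
      (integrable_const (1 : ℝ)).indicator hbadm
    have hbi : Integrable (fun η => ε + bad.indicator (1 : ChainConfig → ℝ) η) μ :=
      (integrable_const ε).add hind
    calc |μ.real A - L| = |∫ η, (g η - L) ∂μ| := by
          rw [integral_sub hgi (integrable_const L), integral_const, smul_eq_mul,
            probReal_univ, one_mul, hDLR]
      _ ≤ ∫ η, |g η - L| ∂μ := abs_integral_le_integral_abs
      _ ≤ ∫ η, (ε + bad.indicator (1 : ChainConfig → ℝ) η) ∂μ :=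
          integral_mono (hgi.sub (integrable_const L)).abs hbi hpt
      _ = ε + μ.real bad := by
          rw [integral_add (integrable_const ε) hind,
            integral_const, smul_eq_mul, probReal_univ, one_mul, integral_indicator_one hbadm]
      _ ≤ 3 * ε := by linarith
  have h0 : |μ.real A - L| ≤ 0 := le_of_forall_pos_lt_add fun ε hε => by
    have := hbound (ε / 4) (by positivity)
    linarith
  linarith [abs_nonneg (μ.real A - L), abs_eq_zero.1 (le_antisymm h0 (abs_nonneg _))]

end OscillatorChain

end Literature.MathematicalPhysics.KineticTheory.HeatConduction

end
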